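import Summits.ResolutionOfSingularities.ResolutionOfSingularities.Theses.HilbertSamuelElimination
import Summits.ResolutionOfSingularities.ResolutionOfSingularities.Theorems.HilbertSamuelEliminationSigmaMaxModificationsReductionBase
import Summits.ResolutionOfSingularities.ResolutionOfSingularities.Theorems.HilbertSamuelEliminationSigmaMaxModificationsCorridor3LevelRaiseDim
import Summits.ResolutionOfSingularities.ResolutionOfSingularities.Theorems.HilbertSamuelEliminationSigmaMaxModificationsCorridor3TameWildDefs
import Summits.ResolutionOfSingularities.ResolutionOfSingularities.Theorems.HilbertSamuelEliminationSigmaMaxModificationsGradedGlue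
import Summits.ResolutionOfSingularities.ResolutionOfSingularities.Theorems.HilbertSamuelEliminationSigmaMaxModificationsSurfaceNuMods
import Summits.ResolutionOfSingularities.ResolutionOfSingularities.Theorems.HilbertSamuelEliminationModificationsResolveDenseComplMaxLocus
import Literature.AlgebraicGeometry.Resolution.MarkedIdeals
import Literature.AlgebraicGeometry.Resolution.BlowupSequences
import Mathlib.AlgebraicGeometry.Morphisms.Proper
import Mathlib.AlgebraicGeometry.Noetherian
import Mathlib.FieldTheory.Perfect
import HarnessLib
import Summits.ResolutionOfSingularities.ResolutionOfSingularities.Theorems.HilbertSamuelEliminationCampaignW42TertiaryReduction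
import Summits.ResolutionOfSingularities.ResolutionOfSingularities.Theorems.HilbertSamuelEliminationCampaignW42TertiaryLiveness
import Summits.ResolutionOfSingularities.ResolutionOfSingularities.Theorems.HilbertSamuelEliminationCampaignW42NearChainCorridor3
import Literature.AlgebraicGeometry.CossartJannsenSaito2020.KeyTheoremsIsolated
import Literature.AlgebraicGeometry.Resolution.HilbertSamuelStrata
import Literature.AlgebraicGeometry.Resolution.BlowupSequencesAppend
import Literature.AlgebraicGeometry.Resolution.SurfaceResolutionPermissibleCentres
import Summits.ResolutionOfSingularities.ResolutionOfSingularities.Theorems.HilbertSamuelEliminationSigmaMaxModificationsCorridor3WLadder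
import Summits.ResolutionOfSingularities.ResolutionOfSingularities.Theorems.HilbertSamuelEliminationCampaignW42TertiaryCorridor3
import Summits.ResolutionOfSingularities.ResolutionOfSingularities.Theorems.HilbertSamuelEliminationCampaignW42TertiaryGenuine
import Summits.ResolutionOfSingularities.ResolutionOfSingularities.Theorems.HilbertSamuelEliminationCampaignW42NearChain
import Literature.AlgebraicGeometry.Resolution.DirectrixScheme
import Summits.ResolutionOfSingularities.ResolutionOfSingularities.Theorems.HilbertSamuelEliminationSigmaMaxModificationsCorridor3WLadderMovingRows
import Summits.ResolutionOfSingularities.ResolutionOfSingularities.Theorems.HilbertSamuelEliminationSigmaMaxModificationsCorridor3WLadderMovingCompactness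
import Literature.AlgebraicGeometry.Resolution.PermissibleBlowupDirectrix
import Summits.ResolutionOfSingularities.ResolutionOfSingularities.Theorems.HilbertSamuelEliminationSigmaMaxModificationsCorridor3WLadderThirdDoor
import Summits.ResolutionOfSingularities.ResolutionOfSingularities.Theorems.HilbertSamuelEliminationSigmaMaxModificationsCorridor3WMono
import Summits.ResolutionOfSingularities.ResolutionOfSingularities.Theorems.HilbertSamuelEliminationSigmaMaxModificationsCorridor3RegimeGlue
import HarnessLib

/-!
# [OURS · L1 W4.2] THE RESIDUE OF THE CRUX `SigmaMaxModificationsCorridor3`, IN THE KERNEL (line `w_ladder` v6, every closed piece inlined):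
# the conjunct follows from SIX PRINTED FACTS of Cossart–Jannsen–Saito and SIX OURS STATEMENTS — the three W-low-char CONSTRUCTIONS,
# the W-low-two row (`p = 2`), and the two W-top rows (THE CORE). Crux chain w42, LEAD PROVER res-L1-w42-lead-1 gen 3.

OURS (cell res-hironaka, slot W4.2); NOT statements of H. Hironaka's manuscript [Hironaka2017] nor of [CossartJannsenSaito2020]; AI proving,
weaker than expert review. CONDITIONAL theorem — it credits nothing and closes nothing; it is the honest CENSUS of the line as ONE checkable
statement (the registered skeleton says the same with `sorry`d stubs). `--supports stmt-ResolutionOfSingularities-19249`.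

`sigmaMaxModificationsCorridor3_of_residue`: `SigmaMaxModificationsCorridor3` (stmt-ResolutionOfSingularities-19249) follows from
* PRINTED (named facts of the tree — ports, not lemmas): CJS Thm. 6.28 ν-form `CossartJannsenSaito2020_nuElimination`, Thm. 1.2 sequence form
  `CossartJannsenSaito2020SequencePermissible`, Thm. 3.10 (4) `CossartJannsenSaito2020_thm_3_10_4` (p499783), Thm. 6.40 at isolated points under
  (F1) `KeyTheorem640_char_isolated`, Cor. 6.37 under (F1) `Corollary637_char`, Thm. 3.14 `CossartJannsenSaito2020_thm_3_14` (p499700);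
* OURS, the W-low-char residue in the (F1) regime: `Moving.IsoE1BridgeM p` (third-door residue, p506497), `Moving.UnitTowerExtractionQM p`
  (unit towers along recurrently-isolated moving chains), `Moving.Wlow3CharStrataM p` (strata half, G1′) — CONSTRUCTIONS of the B1′ /
  localisation programme, in flight (res-L1-w42-stub-2 / -stub-4 / res-type-053);
* OURS, outside (F1) (`p = 2`, `dim X = 3`): the row `Moving.Wlow3TwoM p` (res-L1-w42-stub-3; assembled modulo the residue R_β of CHAIN v3.9 (M));
* OURS, THE CORE (obstruction O2 of CJS §1.3 in starvation-free maximal-origin form): `Moving.Wtop3PointedM p`, `Moving.Wtop3NonpointedM p`.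
Everything else of the line is CLOSED in the tree and used here by name: L∞ `WLadder.stub_movingCompactness` (p500208), W-mono
`Helpers.stub_Wmono_of_thm_3_10_4` (p500936), the third-door reduction `wlow3CharM_of_constructions` (p506497), the moving calibration
`Moving.WA3M_of_CJS` / `WB3M_of_rows5` / `nuMod_three_of_WAM_WBM` (p496426/p496865), graded glue `stub_gradedGlue`, curves `stub_curve`,
level-`2` surfaces `stub_nuMods_surface_of_nuFact`, level raising `levelRaiseDim` (the composition below is the registered skeleton's, v6
bec1bc9e9d6383b2, with its stubs replaced by the hypotheses / the landed closures).

## References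

* V. Cossart, U. Jannsen, S. Saito, LNM 2270 (2020), Thm. 1.2, Thm. 3.10, Thm. 3.14, Def. 6.14/6.15, Rem. 6.24, Thm. 6.28, Rem. 6.29,
  Def. 6.34, Thm. 6.35, Cor. 6.37, Def. 6.38, Thm. 6.40, §1.3 (O2). [CossartJannsenSaito2020]
-/

noncomputable section

set_option linter.dupNamespace false -- mandated namespace of this single-conjunct summit

open CategoryTheory AlgebraicGeometry TopologicalSpace Topology
open Literature.AlgebraicGeometry.Resolution Literature.RingTheory.HilbertSamuel
open Literature.AlgebraicGeometry.CossartJannsenSaito2020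
open Summit.ResolutionOfSingularities.ResolutionOfSingularities.Theses.HilbertSamuelElimination
open Summit.ResolutionOfSingularities.ResolutionOfSingularities.Theorems.SigmaMaxModifications.Sketch
open Summit.ResolutionOfSingularities.ResolutionOfSingularities.Theorems.ModificationsResolve.Sketch
open Summit.ResolutionOfSingularities.ResolutionOfSingularities.Theorems.SigmaMaxModificationsCorridor3
open Summit.ResolutionOfSingularities.ResolutionOfSingularities.Theorems.SigmaMaxModificationsCorridor3.TameWild
open Summit.ResolutionOfSingularities.ResolutionOfSingularities.Theorems.SigmaMaxModificationsCorridor3.Helpers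
open Summit.ResolutionOfSingularities.ResolutionOfSingularities.Theorems.SigmaMaxModificationsCorridor3.Moving
open Summit.ResolutionOfSingularities.ResolutionOfSingularities.Theorems.CampaignW42
open Summit.ResolutionOfSingularities.ResolutionOfSingularities.Cruxes.SigmaMaxModificationsCorridor3.WLadder (stub_movingCompactness)

namespace Summit.ResolutionOfSingularities.ResolutionOfSingularities.Theorems.SigmaMaxModificationsCorridor3.Residue

/-- **WB (moving, level `3`) from the residue**: W-mono (CLOSED modulo Thm. 3.10 (4), p500936), W-low-char through the reduced third door
(p506497) from its three printed binders and three OURS constructions, and the three remaining OURS rows.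
[cite: CossartJannsenSaito2020, Thm. 3.10 (4), Thm. 6.40, Cor. 6.37, Thm. 3.14] -/
theorem WB3M_of_residue (h310 : CossartJannsenSaito2020_thm_3_10_4.{0}) (hK : KeyTheorem640_char_isolated.{0})
    (hC : Corollary637_char.{0}) (h314 : CossartJannsenSaito2020_thm_3_14.{0}) (hB : ∀ p : ℕ, p.Prime → IsoE1BridgeM p)
    (hU : ∀ p : ℕ, p.Prime → UnitTowerExtractionQM p) (hS : ∀ p : ℕ, p.Prime → Wlow3CharStrataM p)
    (hTwo : ∀ p : ℕ, p.Prime → Wlow3TwoM.{0} p) (hTopP : ∀ p : ℕ, p.Prime → Wtop3PointedM.{0} p)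
    (hTopN : ∀ p : ℕ, p.Prime → Wtop3NonpointedM.{0} p) : WB3M :=
  WB3M_of_rows5 (stub_Wmono_of_thm_3_10_4 h310) (fun p hp => wlow3CharM_of_constructions hK hC h314 (hB p hp) (hU p hp) (hS p hp))
    hTwo hTopP hTopN

/-- **WA (moving) from CJS Thm. 1.2** and the LANDED L∞ `WLadder.stub_movingCompactness` (p500208). [cite: CossartJannsenSaito2020, Thm. 1.2, Rem. 6.29 (1)] -/
theorem WA3M_of_sequencePermissible (hSeq : CossartJannsenSaito2020SequencePermissible.{0}) : WA3M :=
  WA3M_of_CJS stub_movingCompactness hSeq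

/-- **Every level on the class `{dim ≤ 3}`.** Induction on `N`: `dim X ≤ N - 1` by
`levelRaiseDim` (p456602, `d = 3`); `dim X = N` a binding level — curves (landed), surfaces at level
`2` (graded glue of the CJS ν-fact, landed), threefolds at level `3` (`nuMod_three`).
[cite: CossartJannsenSaito2020, Def. 6.15, Rem. 2.29 (b)] -/
theorem hsBody_of_dim_le_three (hNu : CossartJannsenSaito2020_nuElimination.{0})
    (hThree : ∀ (p : ℕ), p.Prime → ∀ (k : Type) [Field k] [CharP k p],
      ∀ (Y : Scheme.{0}) (g : Y ⟶ Spec (.of k)), IsSeparated g → LocallyOfFiniteType g →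
        QuasiCompact g → IsReduced Y → topologicalKrullDim Y ≤ ((3 : ℕ) : WithBot ℕ∞) →
        topologicalKrullDim Y ≤ ((3 : ℕ) : WithBot ℕ∞) →
        ∀ ν : ℕ → ℕ, Maximal (· ∈ Scheme.hsValues Y 3) ν → ν ≠ iterPSum 3 Phi → NuMod Y 3 3 ν)
    (p : ℕ) (hp : p.Prime) (k : Type) [Field k] [CharP k p] :
    ∀ (N : ℕ) (X : Scheme.{0}) (f : X ⟶ Spec (.of k)), IsSeparated f →
      LocallyOfFiniteType f → QuasiCompact f → IsReduced X → ¬ Scheme.IsRegular X →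
      topologicalKrullDim X ≤ ((3 : ℕ) : WithBot ℕ∞) → topologicalKrullDim X ≤ (N : WithBot ℕ∞) →
      HSBody X N := by
  intro N
  induction N with
  | zero =>
    intro X f hsep hft hqc hred hreg _ hdim
    exact stub_curve stub_curveResolution k X f hsep hft hqc hred hreg
      (hdim.trans (by exact_mod_cast (by omega : 0 ≤ 1))) 0 hdim
  | succ N ih =>
    intro X f hsep hft hqc hred hreg hd3 hdim
    rcases dim_le_or_succ_le (topologicalKrullDim X) N with h | h
    · exact levelRaiseDim k 3 N ih X f hsep hft hqc hred hreg hd3 h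
    · have hN3 : N + 1 ≤ 3 := by exact_mod_cast h.trans hd3
      rcases Nat.lt_or_ge (N + 1) 2 with h1 | h2
      · exact stub_curve stub_curveResolution k X f hsep hft hqc hred hreg
          (hdim.trans (by exact_mod_cast (by omega : N + 1 ≤ 1))) (N + 1) hdim
      rcases h2.eq_or_lt with h2 | h3
      · -- surfaces at level `2`: graded glue of the CJS ν-eliminations (all landed)
        obtain rfl : N = 1 := by omega
        exact TameWild.hsBody_of_nuMods' k 2 2
          (fun Y g hsep hft hqc hred hd hd' ν hν hνΦ =>
            stub_nuMods_surface_of_nuFact hNu k 2 le_rfl Y g hsep hft hqc hred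
              hd hd' ν hν hνΦ)
          X f hsep hft hqc hred hreg hdim hdim
      · -- threefolds at level `3`
        obtain rfl : N = 2 := by omega
        exact TameWild.hsBody_of_nuMods' k 3 3 (hThree p hp k) X f hsep hft hqc hred hreg hdim hdim


/-- **THE RESIDUE OF `SigmaMaxModificationsCorridor3` (line `w_ladder` v6), one kernel statement**: the conjunct from six PRINTED facts
(CJS Thm. 6.28 ν-form, Thm. 1.2 sequence form, Thm. 3.10 (4), Thm. 6.40 isolated (F1), Cor. 6.37 (F1), Thm. 3.14) and six OURS statements
(W-low-char constructions `IsoE1BridgeM`, `UnitTowerExtractionQM`, `Wlow3CharStrataM`; the `p = 2` row `Wlow3TwoM`; THE CORE `Wtop3PointedM`,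
`Wtop3NonpointedM`). CONDITIONAL — credits nothing. [OURS · L1 W4.2]; NOT a statement of the manuscript.
[cite: CossartJannsenSaito2020, Def. 6.15, Rem. 6.29, Thm. 1.2, Thm. 3.10, Thm. 3.14, Thm. 6.28, Cor. 6.37, Thm. 6.40] -/
theorem sigmaMaxModificationsCorridor3_of_residue
    (hNu : CossartJannsenSaito2020_nuElimination.{0}) (hSeq : CossartJannsenSaito2020SequencePermissible.{0})
    (h310 : CossartJannsenSaito2020_thm_3_10_4.{0}) (hK : KeyTheorem640_char_isolated.{0}) (hC : Corollary637_char.{0})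
    (h314 : CossartJannsenSaito2020_thm_3_14.{0})
    (hB : ∀ p : ℕ, p.Prime → IsoE1BridgeM p) (hU : ∀ p : ℕ, p.Prime → UnitTowerExtractionQM p)
    (hS : ∀ p : ℕ, p.Prime → Wlow3CharStrataM p) (hTwo : ∀ p : ℕ, p.Prime → Wlow3TwoM.{0} p)
    (hTopP : ∀ p : ℕ, p.Prime → Wtop3PointedM.{0} p) (hTopN : ∀ p : ℕ, p.Prime → Wtop3NonpointedM.{0} p) :
    SigmaMaxModificationsCorridor3 := by
  intro p hp k _ _ X f hsep hft hqc hred hreg _ h3' N hdim _ _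
  exact hsBody_of_dim_le_three hNu
    (nuMod_three_of_WAM_WBM (WA3M_of_sequencePermissible hSeq) (WB3M_of_residue h310 hK hC h314 hB hU hS hTwo hTopP hTopN))
    p hp k N X f hsep hft hqc hred hreg h3' hdim

end Summit.ResolutionOfSingularities.ResolutionOfSingularities.Theorems.SigmaMaxModificationsCorridor3.Residue

end
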